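import Summits.BirchSwinnertonDyer.BirchSwinnertonDyer.Theorems.EdixhovenFibreFiveSevenManinSideOfCDTInt
import Literature.NumberTheory.Automorphic.UnboundedDenominatorsOfCor453
import HarnessLib

/-! # Line `cdt_thm1` — skeleton v17 for crux K★ `StarredOptimalManinUnitFiveSeven` (stmt-BirchSwinnertonDyer-22226)

v17 (LEAD edix-p1 g40, 2026-08-31): ONE stub, ONE import.  The whole of CDT Theorem 1.0.1 except Corollary 4.5.3 is now in the
Literature tree: `CalegariDimitrovTang2025_unboundedDenominators.of_cor453_invariant` (p821622; `hker₂` = amalgam + CSP discharged by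
`IharaAmalgam.exists_level_of_intertwined`, p821550), so the composition is the one-liner
`unboundedDenominators_of_stubs := of_cor453_invariant stub_hcor_invariant` and the stub `stub_hker2` of v14–v16 is gone (it is the tree
theorem `…Theorems.StarredOptimalManinUnitFiveSevenHker2.stub_hker2`, p820946).  `stub_hcor_invariant` is EQUIVALENT (kernel-checked both ways,
`…Theorems.StarredOptimalManinUnitFiveSevenHcorReduction`, p821346/p821686) to «∀ N ≥ 1 ∃ M ≠ 0: Γ(M) ∩ Γ(N) ≤ [SL₂(ℤ), Γ(N)]»
(a Schur-multiplier statement: Beyl 1986 / CDT Thm 4.5.2).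

v16 (LEAD edix-p1 g40, 2026-08-31): ONE stub.  v15's `stub_hker2` (amalgam + congruence subgroup property for `SL₂(ℤ[1/p])`,
CDT Lemma 4.4.1/4.6.2) is now a THEOREM of the tree: `…Theorems.StarredOptimalManinUnitFiveSevenHker2.stub_hker2` (p820946), from
Ihara's theorem formalised by ping-pong on `ℙ¹(ℚ)` (`Literature/GroupTheory/ArithmeticGroups/IharaAmalgam{PingPong,Lift,Generation}.lean`,
p820505/p820607/p820776) and the tree's proved CSP `SerreSL2Congruence1970_congruenceSubgroupProperty_away_holds`.  The only remaining
stub is `stub_hcor_invariant` (CDT Cor. 4.5.3 in invariant form ⟺ `[SL₂(ℤ), Γ(N)]` is a congruence subgroup for every `N`; Beyl 1986 /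
CDT Thm. 4.5.2).

v15 (edix-p4 g39, 2026-08-31): TWO stubs.  v14's `stub_hShimura` (Shimura 3.52) and `stub_hdeg` ((4.3.3)) are now THEOREMS of the
tree — `…UnboundedDenominators.hrat_of_even` (rationality of `M_N` by a Galois squeeze: Artin's lemma + the sharp degree count,
p819741/p819769/p820166) and `…UnboundedDenominators.relfinrank_levelField_ge` (p819465) — and the composition is
`CalegariDimitrovTang2025_unboundedDenominators.of_two_inputs` (p820166): CDT Thm 1.0.1 ⟸ {stub_hker2, stub_hcor_invariant}.

v14 (LEAD g39, 2026-08-31).  v13's single stub — the vendored Unbounded Denominators Theorem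
`Literature.NumberTheory.Automorphic.CalegariDimitrovTang2025_unboundedDenominators` (CDT, J. AMS 38 (2025) Thm. 1.0.1) — is now
PROVED IN THE TREE MODULO FOUR PRINTED CLASSICAL INPUTS (gens 38–39, seats edix-p1/edix-p4; ~40 accepted Literature files):
Prop. 3.0.1 (dimension bound, Nevanlinna/BC/Dirichlet), Thm. 5.1.4 (conformal radius of `ℂ ∖ μ_N`), Remark 3.0.2 (continuation),
§§4.1–4.3, 4.6 (fields `R_N ⊇ M_N`, leveraging, Ihara enhanced) and §6.3 (holonomic bound (6.3.1) + assembly) are kernel-checked: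
`CalegariDimitrovTang2025_unboundedDenominators.of_printed_inputs'''` (p818775).  v14 therefore registers FOUR stubs, each a
published statement with a locator, composed BY NAME:
* `stub_hker2` — two-sided congruence kernel of the amalgam `Γ(N) *_{Γ(N)∩Γ₀(p)} A⁻¹Γ(N)A ≅ Γ̃(N) ≤ SL₂(ℤ[1/p])` + the congruence
  subgroup property of `SL₂(ℤ[1/p])` [Serre, Trees II.1.4; Mennicke 1967; Serre 1970] (CDT Lemmas 4.4.1/4.6.2);
* `stub_hcor_invariant` — CDT Cor. 4.5.3 in INVARIANT form (an `SL₂(ℤ)`-conjugation-invariant homomorphism `Γ(N) → Q`, `Q` finite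
  abelian, is trivial on some `Γ(M)`; CDT Thm. 4.5.2 `H̃¹(𝐅_ℓ)^{SL₂(ℤ̂)} = 0`), fed through `cor453_of_invariant_form` (p819087);
* `stub_hShimura` — Shimura 1971 Thm. 3.52: `M_{12m}(Γ(N))` is spanned by forms with rational-integer `q_N`-expansion;
* `stub_hdeg` — (4.3.3): `[M_N : M_2] ≥ c N³` for even `N` (IN PROGRESS, edix-p4 g39 D1–D6 with LEAD's Eisenstein witness p819304).
The composition is v13's: CDT Thm 1 ⟹ `|c₀| = 1` (cell bsd-f2-manin, Honda/Wohlfahrt/Ling–Oesterlé) ⟹ K★ (p811415).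

K★ stays OPEN on the ledger; this file is CONDITIONAL bookkeeping.  BSD is not proved; Manin's conjecture is not proved; K★ is not proved.
[cite: CalegariDimitrovTang2025, Thm. 1.0.1, §§3–6] [cite: Honda1970, Thm. 9] [cite: Wohlfahrt1964, Thm. 2] [cite: LingOesterle1991, Thm. 6] -/

set_option autoImplicit false
set_option linter.dupNamespace false

noncomputable section

open scoped MatrixGroups ModularForm
open CongruenceSubgroup Matrix.SpecialLinearGroup UpperHalfPlane
  Literature.NumberTheory.Automorphic Literature.NumberTheory.Automorphic.UnboundedDenominators

namespace Summit.BirchSwinnertonDyer.BirchSwinnertonDyer.Cruxes.StarredOptimalManinUnitFiveSeven.CdtThm1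

/-- **The one stub — CDT Corollary 4.5.3, invariant form**: an `SL₂(ℤ)`-conjugation-invariant homomorphism from `Γ(N)` to a finite
abelian group is trivial on some principal congruence subgroup. [cite: CalegariDimitrovTang2025, Corollary 4.5.3 and Theorem 4.5.2] -/
theorem stub_hcor_invariant : ∀ (N : ℕ) (Q : Type) [CommGroup Q] [Finite Q] (θ : Gamma N →* Q),
      (∀ (g x : SL(2, ℤ)) (hx : x ∈ Gamma N) (hgx : g * x * g⁻¹ ∈ Gamma N),
        θ ⟨g * x * g⁻¹, hgx⟩ = θ ⟨x, hx⟩) →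
      ∃ M : ℕ, M ≠ 0 ∧ ∀ (x : SL(2, ℤ)) (hx : x ∈ Gamma N), x ∈ Gamma M → θ ⟨x, hx⟩ = 1 := by
  sorry

/-- **CDT Theorem 1.0.1 from the one stub** (no sorry of its own): `of_cor453_invariant` (LEAD g40, p821622; it packages
`of_two_inputs` (edix-p4 g39), Ihara's amalgam + CSP (`IharaAmalgam.exists_level_of_intertwined`, p821550) and
`cor453_of_invariant_form` (p819087)). [cite: CalegariDimitrovTang2025, Thm. 1.0.1 and §6.3] -/
theorem unboundedDenominators_of_stubs :
    Literature.NumberTheory.Automorphic.CalegariDimitrovTang2025_unboundedDenominators :=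
  CalegariDimitrovTang2025_unboundedDenominators.of_cor453_invariant stub_hcor_invariant

/-- **The composition ⟹ K★ BY NAME** (no sorry of its own): LEAD g36's landed conditional closer
`…Theorems.EdixhovenFibreFiveSevenOfCDTInt.starredOptimalManinUnitFiveSeven_of_CDTInt : CDT-Thm-1 → K★` (p811415) applied to
`unboundedDenominators_of_stubs`. [cite: CalegariDimitrovTang2025, Thm. 1.0.1] [cite: LingOesterle1991, Thm. 6] -/
theorem StarredOptimalManinUnitFiveSeven_of :
    Summit.BirchSwinnertonDyer.BirchSwinnertonDyer.Theses.EdixhovenFibreFiveSeven.StarredOptimalManinUnitFiveSeven :=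
  Summit.BirchSwinnertonDyer.BirchSwinnertonDyer.Theorems.EdixhovenFibreFiveSevenOfCDTInt.starredOptimalManinUnitFiveSeven_of_CDTInt
    unboundedDenominators_of_stubs

end Summit.BirchSwinnertonDyer.BirchSwinnertonDyer.Cruxes.StarredOptimalManinUnitFiveSeven.CdtThm1

end
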